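import Mathlib
import Summits.Parity.BatemanHorn.Theses.PolynomialMobius
import Summits.Parity.BatemanHorn.Theorems.IsogenyRedeiPolyMobiusTailStubDegreeOneSlice
import Summits.Parity.BatemanHorn.Theorems.PolyMobiusTail.Negative.Structure
import Literature.NumberTheory.Sieve.BatemanHornProofs

/-!
# Crux `PolyMobiusTail` (stmt-Parity-0870), line `eta-free-multilinear-window`:
# stub `stub_window_linear_le_one` — the WINDOW for systems with `k ≤ 1` members of degree `≤ 1`

For a Bateman–Horn system `f : Fin k → ℤ[X]` with `k ≤ 1` and every member of degree `≤ 1`, some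
window `(x^{1-η}, x^{1+θ}]` of the Möbius tail is `o(x)`:

  `Σ_{n ≤ x} Σ_{dᵢ ∣ fᵢ(n), x^{1-η} < ∏ dᵢ ≤ x^{1+θ}} ∏ μ(dᵢ) log dᵢ = o(x)`.

We take `θ = η = 1/2`.

* `k = 0`: the only divisor tuple is the empty one, `∏∅ = 1 ≤ x^{1/2}` for `x ≥ 1`, so every summand
  vanishes and the window function is eventually `0`.
* `k = 1`: a Bateman–Horn member is non-constant (`IsBatemanHornSystem.natDegree_pos`: a positive
  irreducible constant would be a fixed prime divisor), so `(f 0).natDegree = 1` and the landed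
  degree-one slice `NaturalForm.stub_degreeOneSlice` (p114749) gives the tail at cut `x^{1/2}` — WITHOUT
  the upper cut — as `o(x)`.  The upper cut is eventually immaterial: a divisor `d ∣ f(n)`, `n ≤ x`,
  satisfies `d ≤ f(n) ≤ B·n ≤ B·x ≤ x^{3/2}` once `x ≥ B²` (`Negative.toNat_eval_le_mul_pow`), so the
  window and the tail agree eventually (`Asymptotics.IsLittleO.congr'`).
-/

open scoped BigOperators
open Filter Finset Polynomial Asymptotics

namespace Summit.Parity.BatemanHorn.Theorems.PolyMobiusTail.EtaFreeWindow

open Literature.NumberTheory.Sieve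

/-- Linear growth of a polynomial of degree `≤ 1` along `ℕ`, in `toNat` form: `f(n)⁺ ≤ B·n` for
`n ≥ 1`, with `B = Σⱼ |aⱼ|`. [folklore] -/
private theorem toNat_eval_le_linear (g : ℤ[X]) (hg : g.natDegree ≤ 1) :
    ∃ B : ℕ, ∀ n : ℕ, 1 ≤ n → (g.eval (n : ℤ)).toNat ≤ B * n := by
  refine ⟨∑ j ∈ Finset.range (g.natDegree + 1), (g.coeff j).natAbs, fun n hn => ?_⟩
  refine (Negative.toNat_eval_le_mul_pow g hn).trans (Nat.mul_le_mul_left _ ?_)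
  calc n ^ g.natDegree ≤ n ^ 1 := Nat.pow_le_pow_right hn hg
    _ = n := pow_one n

/-- For a fixed natural `B`, eventually `B·x ≤ x^{3/2}` (namely once `x ≥ B²`). [folklore] -/
private theorem eventually_mul_le_rpow (B : ℕ) :
    ∀ᶠ x : ℕ in atTop, (B : ℝ) * x ≤ (x : ℝ) ^ (1 + 1 / 2 : ℝ) := by
  filter_upwards [eventually_ge_atTop (B ^ 2), eventually_ge_atTop 1] with x hxB hx1
  have hx0 : (0 : ℝ) < x := by exact_mod_cast hx1
  have hBle : (B : ℝ) ≤ (x : ℝ) ^ (1 / 2 : ℝ) := by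
    rw [← Real.sqrt_eq_rpow]
    exact Real.le_sqrt_of_sq_le (by exact_mod_cast hxB)
  rw [Real.rpow_add hx0, Real.rpow_one, mul_comm]
  exact mul_le_mul_of_nonneg_left hBle hx0.le

/-- **Stub `stub_window_linear_le_one` (line `eta-free-multilinear-window`): the WINDOW for linear
systems with `k ≤ 1`.** For a Bateman–Horn system of at most one member, of degree `≤ 1`, some window
`(x^{1-η}, x^{1+θ}]` of the Möbius tail is `o(x)`:
`Σ_{n≤x} Σ_{dᵢ∣fᵢ(n), x^{1-η} < ∏dᵢ ≤ x^{1+θ}} ∏ μ(dᵢ) log dᵢ = o(x)` (here with `θ = η = 1/2`).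
`k = 0`: every summand vanishes (`∏∅ = 1 ≤ x^{1/2}` for `x ≥ 1`).  `k = 1`: degree `0` is excluded by the
Bateman–Horn axioms (`IsBatemanHornSystem.natDegree_pos`), the tail at cut `x^{1/2}` is `o(x)` by the landed
degree-one slice `NaturalForm.stub_degreeOneSlice`, and the upper cut `∏ dᵢ ≤ x^{3/2}` holds automatically on
the support once `x ≥ B²` (`d ∣ f(n)`, `f(n) ≤ B·n ≤ B·x`), so window and tail agree eventually. [folklore] -/
theorem stub_window_linear_le_one : ∀ (k : ℕ) (f : Fin k → ℤ[X]), IsBatemanHornSystem f → k ≤ 1 →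
    (∀ i, (f i).natDegree ≤ 1) →
    ∃ θ : ℝ, 0 < θ ∧ θ < 1 ∧ ∃ η : ℝ, 0 < η ∧ η < 1 ∧
      (fun x : ℕ => ∑ n ∈ Finset.Icc 1 x,
        ∑ d ∈ Fintype.piFinset (fun i => (((f i).eval (n : ℤ)).toNat).divisors),
          if (x : ℝ) ^ (1 - η) < ∏ i, (d i : ℝ) ∧ ∏ i, (d i : ℝ) ≤ (x : ℝ) ^ (1 + θ) then
            ∏ i, ((ArithmeticFunction.moebius (d i) : ℝ) * Real.log (d i)) else 0)
        =o[atTop] fun x : ℕ => (x : ℝ) := by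
  intro k f hf hk hdeg
  refine ⟨1 / 2, by norm_num, by norm_num, 1 / 2, by norm_num, by norm_num, ?_⟩
  obtain rfl | rfl : k = 0 ∨ k = 1 := by omega
  · -- `k = 0`: the only divisor tuple is the empty one, `∏∅ = 1 ≤ x^{1/2}` for `x ≥ 1`.
    refine (isLittleO_zero (fun x : ℕ => (x : ℝ)) atTop).congr' ?_ EventuallyEq.rfl
    filter_upwards [eventually_ge_atTop 1] with x hx
    symm
    refine Finset.sum_eq_zero fun n _ => Finset.sum_eq_zero fun d _ => ?_
    rw [if_neg]
    rintro ⟨h, -⟩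
    rw [Finset.univ_eq_empty, Finset.prod_empty] at h
    exact absurd h (not_lt.mpr (Real.one_le_rpow (by exact_mod_cast hx) (by norm_num)))
  · -- `k = 1`: degree exactly `1`, tail `o(x)` by the degree-one slice, upper cut eventually immaterial.
    have hd1 : (f 0).natDegree = 1 := le_antisymm (hdeg 0) (hf.natDegree_pos 0)
    have htail := NaturalForm.stub_degreeOneSlice f hf hd1 (1 / 2) (by norm_num) (by norm_num)
    obtain ⟨B, hB⟩ := toNat_eval_le_linear (f 0) (hdeg 0)
    refine htail.congr' ?_ EventuallyEq.rfl
    filter_upwards [eventually_mul_le_rpow B] with x hx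
    refine Finset.sum_congr rfl fun n hn => Finset.sum_congr rfl fun d hd => ?_
    obtain ⟨hn1, hnx⟩ := Finset.mem_Icc.mp hn
    have hd0 : d 0 ≤ B * x :=
      (Nat.divisor_le (Fintype.mem_piFinset.mp hd 0)).trans
        ((hB n hn1).trans (Nat.mul_le_mul_left _ hnx))
    have hup : ∏ i, (d i : ℝ) ≤ (x : ℝ) ^ (1 + 1 / 2 : ℝ) := by
      rw [Fin.prod_univ_one]
      exact le_trans (by exact_mod_cast hd0) hx
    simp only [hup, and_true]

end Summit.Parity.BatemanHorn.Theorems.PolyMobiusTail.EtaFreeWindow
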